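import Summits.BirchSwinnertonDyer.BirchSwinnertonDyer.Theses.PrintCf2
import Summits.BirchSwinnertonDyer.Rank1Residual.P2.ShuZhaiTwoFiftySixSlices
import HarnessLib

/-!
# Route PrintCf2 — aside item `RamifiedShuZhaiTwoFiftySixOfFactsPlus` (stmt-BirchSwinnertonDyer-21183) CLOSED

Cell `bsd-print-cf2` (D-0131 (2) PRINT TIER, leaf CornerF @ `p = 2`), prover p2 («2-descent matrix road»). The
aside is the planner's typed spec (route rev 10, PREDICATE form) of the Shu–Zhai door at the RAMIFIED CM base
`256c1 : y² = x³ + 2x` (lit g3 DOSSIER §16): granted the twin bundle 𝔅_ram⁺ = 𝔅_ram (the eleven facts of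
`RamifiedTwoRankOneOfFacts`, VERBATIM) ∧ Shu–Zhai 2021 Thm 1.2 ∧ Thm 1.4 ∧ Agashe–Ribet–Stein 2006 Thm 2.6 ∧ the
base entry `ShuZhai2021.base256c1_optimal_cuspZero`, every globally minimal CM curve of analytic rank one with
`2` ramified in `K` that is a `ℚ`-model of `256c1^{(−p∏q)}` — `p ≡ 7 (mod 8)` prime, `Q` a finite set of primes
`≡ 5 (mod 8)` with `∏ q ≡ 1 (mod 8)` — i.e. of `y² = x³ + 2p²M²x`, satisfies `BSD(W,2)`. Proof: destructure the
bundle and apply p2's by-name slice `P2.cornerFTwo_shuZhaiTwoFiftySix_byName'`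
(`P2/ShuZhaiTwoFiftySixSlices.lean`), which needs exactly modularity (conjunct 2), row C8 = Burungale–Flach
(conjunct 4), Shu–Zhai Thm 1.2 / Thm 1.4, ARS06 and the base entry; everything else (the `2`-isogeny, (Tor),
`N ∣ 2⁸`, Heegner at `ℚ(√−p)`, admissibility of `q ≡ 5 (8)`, the `ℚ(√M)` condition, CM, the base certificate
`BSD(256c1, 2)`) is discharged in the kernel (typer ty2's `P2/ShuZhaiTwoFiftySix{Curve,Admissible}.lean`, p2's
`P2/ShuZhaiCMBaseTransport.lean`). The W-ALL leaf `Summit.BirchSwinnertonDyer.WAllCornerFTwoRamifiedShuZhaiTwoFiftySix`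
(isogeny-class form, `WAll/TargetCMTwoRamifiedShuZhaiTwoFiftySix.lean`) is closed from the same bundle plus Cassels
(conjunct 3) by `ramifiedShuZhaiTwoFiftySixLeaf_of_bundlePlus`. beyond-print: NO (this IS print).
[cite: ShuZhai2021, Thm. 1.2, Thm. 1.4 (arXiv:2102.11808 chunk p0003 L24–L45)]
[cite: Cremona1997, Table 1 (N = 256, curve C1) and Table 4 (row 256C)] [cite: AgasheRibetStein2006, Thm. 2.6]
[cite: BurungaleFlach2024, Cor. 2] [cite: MilneADT2006, Thm. I.7.3]
-/

-- single-conjunct summit: `Summit.BirchSwinnertonDyer.BirchSwinnertonDyer.…` repeats the name by design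
set_option linter.dupNamespace false

namespace Summit.BirchSwinnertonDyer.BirchSwinnertonDyer.Theorems

/-- **Item `RamifiedShuZhaiTwoFiftySixOfFactsPlus` (stmt-BirchSwinnertonDyer-21183) holds**: 𝔅_ram⁺ ⟹ `BSD(W,2)`
for every globally minimal `ℚ`-model `W` (CM, analytic rank one, `2` ramified in `K`) of a Shu–Zhai twist
`256c1^{(−p∏q)} = (y² = x³ + 2p²M²x)`, by `P2.cornerFTwo_shuZhaiTwoFiftySix_byName'`.
[cite: ShuZhai2021, Thm. 1.2 and Thm. 1.4] [cite: Cremona1997, Table 1 (N = 256, curve C1) and Table 4 (row 256C)]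
[cite: AgasheRibetStein2006, Thm. 2.6] [cite: BurungaleFlach2024, Cor. 2] -/
theorem ramifiedShuZhaiTwoFiftySixOfFactsPlus_proof :
    Summit.BirchSwinnertonDyer.BirchSwinnertonDyer.Theses.PrintCf2.RamifiedShuZhaiTwoFiftySixOfFactsPlus := by
  unfold Summit.BirchSwinnertonDyer.BirchSwinnertonDyer.Theses.PrintCf2.RamifiedShuZhaiTwoFiftySixOfFactsPlus
  rintro ⟨⟨_, hmod, _, hCM, _⟩, h12, h14, hARS, hbase⟩
  exact Summit.BirchSwinnertonDyer.Rank1Residual.P2.cornerFTwo_shuZhaiTwoFiftySix_byName' h12 h14 hCM hmod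
    hARS hbase

/-- **The W-ALL leaf `WAllCornerFTwoRamifiedShuZhaiTwoFiftySix` (ISOGENY-CLASS form) from the same bundle 𝔅_ram⁺**
(Cassels' invariance = conjunct 3 of 𝔅_ram enters): the by-name slice of the ramified type on the `ℚ`-isogeny
classes of the Shu–Zhai twists of `256c1`, by `wAllCornerFTwoRamifiedShuZhaiTwoFiftySix_of_facts`.
[cite: ShuZhai2021, Thm. 1.2 and Thm. 1.4] [cite: MilneADT2006, Thm. I.7.3]
[cite: Cremona1997, Table 1 (N = 256, curve C1) and Table 4 (row 256C)] [cite: AgasheRibetStein2006, Thm. 2.6] -/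
theorem ramifiedShuZhaiTwoFiftySixLeaf_of_bundlePlus
    (h : (Literature.NumberTheory.EllipticCurves.rank_eq_analyticRank_of_analyticRank_le_one ∧ WeierstrassCurve.hasEntireLFunction_rat ∧ WeierstrassCurve.bsdRHS_eq_of_isIsogenous ∧ Literature.NumberTheory.EllipticCurves.bsdTriple_of_hasCM_of_L_one_ne_zero ∧ Literature.NumberTheory.EllipticCurves.TianYuanZhang2017.thm12_parity_of_scriptL' ∧ Literature.NumberTheory.EllipticCurves.Tian2014.thm13_rank_one_and_sha_odd ∧ Literature.NumberTheory.QuadraticFields.RedeiReichardt.redeiReichardt_fourTwoCard_classGroup ∧ Literature.NumberTheory.EllipticCurves.LiLiuTian2024.thm12_bsd_congruentNumberCurve ∧ Literature.NumberTheory.EllipticCurves.Monsky1990.cor515_rank_eq_one_and_card_selmerGroup_two ∧ Literature.NumberTheory.EllipticCurves.HeathBrown1994.monsky_card_selmerGroup_two_even ∧ Literature.NumberTheory.EllipticCurves.Tian2014.tian2014_system_sMinus_genus) ∧ Literature.NumberTheory.EllipticCurves.ShuZhai2021.thm12_ranks_of_twists ∧ Literature.NumberTheory.EllipticCurves.ShuZhai2021.thm14_twoPartBSD_of_twists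 ∧ Literature.NumberTheory.EllipticCurves.AgasheRibetStein2006.cremona_abs_maninConstant_eq_one_of_level_le ∧ Literature.NumberTheory.EllipticCurves.ShuZhai2021.base256c1_optimal_cuspZero) :
    Summit.BirchSwinnertonDyer.WAllCornerFTwoRamifiedShuZhaiTwoFiftySix := by
  obtain ⟨⟨_, hmod, hCas, hCM, _⟩, h12, h14, hARS, hbase⟩ := h
  exact Summit.BirchSwinnertonDyer.wAllCornerFTwoRamifiedShuZhaiTwoFiftySix_of_facts hCas h12 h14 hCM hmod
    hARS hbase

end Summit.BirchSwinnertonDyer.BirchSwinnertonDyer.Theorems
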